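import Mathlib
import HarnessLib
import Literature.Analysis.FluidPDE.SelfSimilar
import Literature.Analysis.FluidPDE.LocalTypeI
import Literature.Analysis.FluidPDE.VectorCalculus
import Literature.Analysis.FluidPDE.NSBoundedMildOseen
import Literature.Analysis.UnboundedOperators.HeatKernel
import Summits.NavierStokesRegularity.NavierStokesRegularity.Theorems.ChiralWindowDoorDefs
import Summits.NavierStokesRegularity.NavierStokesRegularity.Theorems.ChiralWindowDoorLambda
import Summits.NavierStokesRegularity.NavierStokesRegularity.Theorems.ChiralWindowDoorFracLapHalfBounds
import Summits.NavierStokesRegularity.NavierStokesRegularity.Theorems.ChiralWindowDoorGagliardoIdentity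
import Summits.NavierStokesRegularity.NavierStokesRegularity.Theorems.LocalSineTubeDoorProfileAlignedWindowRigidityAncient

/-!
# Door S20 «ChiralWindowDoor» — stub B1′ `stub_localHelicityLower` PROVED: the localised helicity of a chiral
# door-class slice is almost coercive, `G(a_R, v(t)) ≤ h(a_R, v(t)) + c(η) D²`, uniformly in `R > 0`, `t < 0`

Door S20 of nsreg-p1's local Type-I door family (`HOME/ns-regularity-ideate-p1/r19/R19-LINE.md` §B1′, line
`r19/Sketch20v5.lean` 7f13084196f4f031; DESIGN-ONLY, route NOT born).  With the Gagliardo–`Λ` identity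
(`…ChiralWindowDoorGagliardoIdentity.gagliardo_le_integral_add`: `G(a,f) ≤ ∫a⟪f,Λf⟫ + ½∫‖f‖²|Λa|`), chirality
(`Λ f = curl f` turns the first term into `locHelicity a f`) and the decay `‖v(t,x)‖ ≤ D/‖x‖`, B1′ reduces to the
`R`-UNIFORM bound `½∫‖v‖²|Λ a_R| ≤ ½ D² c₁(η)`, which follows from the exact SCALING `Λ(a_R)(x) = R⁻¹ Λ(a₁)(x/R)` of
the weight `a_R = bumpSq η R = η(·/R)²` and the change of variables `x = Ry` (all powers of `R` cancel:
`R⁻² · R⁻¹ · R³`):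

* `bumpSq_eq_comp_one`, `fracLapHalfS_bumpSq_scale` — `a_R = a₁ ∘ (R⁻¹•)`, `Λ a_R (x) = R⁻¹ Λ a₁ (R⁻¹x)`;
* `contDiff_bumpSq`, `continuous_bumpSq`, `hasCompactSupport_bumpSq`, `exists_secondDiff_bound_bumpSq` — the weight
  meets the hypotheses of the identity;
* `integrable_rpow_mul_abs_fracLapHalfS_bumpSq_one` — `c₁(η) = ∫ ‖y‖⁻² |Λ a₁(y)| dy < ∞` (uniform bound near,
  `‖y‖⁻⁶` far);
* `integral_normSq_mul_abs_fracLapHalfS_le` — `∫‖f‖²|Λ a_R| ≤ D² c₁(η)` for `‖f x‖ ≤ D/‖x‖`, every `R > 0`;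
* `slice_regularity` — a door-class slice is `C²`, bounded by `C/√(−t)`, `K/(−t)`-Lipschitz, with second differences
  `≤ 2K(−t)^{−3/2}‖z‖²` (binder);
* `localHelicityLower` — **stub B1′ of `r19/Sketch20v5.lean` (text verbatim over the tree substrate), PROVED.**

Seat nsreg-p6 g11 (THEOREMS-ONLY door sequels, DIRECTOR-NS g8 #32 (2)/#36).  WHAT THIS IS NOT: not NS regularity
(Clay A); not K2 — one stub of its residue line (B2′, B3, B5a, the spread input and K1 remain OPEN); no route is opened.
-/

noncomputable section

-- the summit and its single sub-problem share the name (CONVENTIONS §1), as in every Theorems file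
set_option linter.dupNamespace false

namespace Summit.NavierStokesRegularity.NavierStokesRegularity.Theorems.ChiralWindowDoorLocalHelicityLower

open MeasureTheory Set Filter Topology Metric Function
open scoped RealInnerProductSpace
open Literature.Analysis Literature.Analysis.FluidPDE
open Summit.NavierStokesRegularity.NavierStokesRegularity.Theorems.ChiralWindowDoorDefs
open Summit.NavierStokesRegularity.NavierStokesRegularity.Theorems.ChiralWindowDoorLambda
open Summit.NavierStokesRegularity.NavierStokesRegularity.Theorems.ChiralWindowDoorFracLapHalfBounds
open Summit.NavierStokesRegularity.NavierStokesRegularity.Theorems.ChiralWindowDoorGagliardoIdentity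
open Summit.NavierStokesRegularity.NavierStokesRegularity.Theorems.LocalSineTubeDoorProfileAlignedWindowRigidityAncient
  (analyticOnNhd_slice bdd_of_hasTypeITimeDecay)

/-! ### The weight `a_R = η(·/R)²`: scaling, regularity -/

/-- `a_R = a₁ ∘ (R⁻¹ • ·)`. -/
theorem bumpSq_eq_comp_one (η : EuclideanSpace ℝ (Fin 3) → ℝ) (R : ℝ) (w : EuclideanSpace ℝ (Fin 3)) :
    bumpSq η R w = bumpSq η 1 (R⁻¹ • w) := by
  simp [bumpSq]

/-- **Scaling of `Λ` on the weights**: `Λ(a_R)(x) = R⁻¹ · Λ(a₁)(R⁻¹ x)` for `R > 0` (no hypotheses on `η`: the Haar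
change of variables holds for junk values too). -/
theorem fracLapHalfS_bumpSq_scale (η : EuclideanSpace ℝ (Fin 3) → ℝ) {R : ℝ} (hR : 0 < R)
    (x : EuclideanSpace ℝ (Fin 3)) :
    fracLapHalfS (bumpSq η R) x = R⁻¹ * fracLapHalfS (bumpSq η 1) (R⁻¹ • x) := by
  set X : EuclideanSpace ℝ (Fin 3) := R⁻¹ • x with hX
  set b : EuclideanSpace ℝ (Fin 3) → ℝ := bumpSq η 1 with hb
  set F : EuclideanSpace ℝ (Fin 3) → ℝ := fun u => lamK u * (2 * b X - b (X + u) - b (X - u)) with hF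
  have hRi : 0 < R⁻¹ := inv_pos.2 hR
  have hint : ∀ z : EuclideanSpace ℝ (Fin 3),
      lamK z * (2 * bumpSq η R x - bumpSq η R (x + z) - bumpSq η R (x - z)) = (R⁻¹) ^ 4 * F (R⁻¹ • z) := by
    intro z
    rw [bumpSq_eq_comp_one η R x, bumpSq_eq_comp_one η R (x + z), bumpSq_eq_comp_one η R (x - z), hF,
      lamK_eq_smul R⁻¹ hRi z]
    simp only [smul_add, smul_sub, hX, hb]
    ring
  unfold fracLapHalfS
  rw [show (fun z : EuclideanSpace ℝ (Fin 3) => lamK z * (2 * bumpSq η R x - bumpSq η R (x + z) - bumpSq η R (x - z)))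
      = fun z => (R⁻¹) ^ 4 * F (R⁻¹ • z) from funext hint]
  rw [integral_const_mul, Measure.integral_comp_smul volume F R⁻¹]
  have hfin : Module.finrank ℝ (EuclideanSpace ℝ (Fin 3)) = 3 := finrank_euclideanSpace_fin
  rw [hfin, abs_of_pos (by positivity : (0 : ℝ) < ((R⁻¹) ^ 3)⁻¹), smul_eq_mul]
  have hFint : ∫ u, F u = ∫ u, lamK u * (2 * b X - b (X + u) - b (X - u)) := rfl
  rw [hFint]
  have hR0 : R ≠ 0 := hR.ne'
  field_simp

variable {η : EuclideanSpace ℝ (Fin 3) → ℝ}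

/-- `a_R` is `C²`. -/
theorem contDiff_bumpSq (hη : IsAdmissibleBump η) (R : ℝ) : ContDiff ℝ 2 (bumpSq η R) := by
  have h : ContDiff ℝ 2 fun y : EuclideanSpace ℝ (Fin 3) => η (R⁻¹ • y) := hη.1.comp (contDiff_const_smul R⁻¹)
  exact h.pow 2

/-- `a_R` is continuous. -/
theorem continuous_bumpSq (hη : IsAdmissibleBump η) (R : ℝ) : Continuous (bumpSq η R) :=
  (contDiff_bumpSq hη R).continuous

/-- `a_R` has compact support (`R > 0`). -/
theorem hasCompactSupport_bumpSq (hη : IsAdmissibleBump η) {R : ℝ} (hR : 0 < R) : HasCompactSupport (bumpSq η R) := by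
  refine HasCompactSupport.intro (isCompact_closedBall (0 : EuclideanSpace ℝ (Fin 3)) (2 * R)) fun x hx => ?_
  exact bumpSq_eq_zero hη hR (le_of_lt (by simpa [mem_closedBall, dist_zero_right] using hx))

/-- `a_R` has quadratic second differences (`C²` with compact support ⇒ `‖D²a_R‖ ≤ A`, then the mean value inequality
twice, `…ChiralWindowDoorLambda.norm_secondDiff_le`). -/
theorem exists_secondDiff_bound_bumpSq (hη : IsAdmissibleBump η) {R : ℝ} (hR : 0 < R) :
    ∃ A₂ : ℝ, ∀ x z : EuclideanSpace ℝ (Fin 3),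
      |2 * bumpSq η R x - bumpSq η R (x + z) - bumpSq η R (x - z)| ≤ A₂ * ‖z‖ ^ 2 := by
  have hcd := contDiff_bumpSq hη R
  have hcs := hasCompactSupport_bumpSq hη hR
  -- a bound on `‖D²a_R‖` through the REAL-valued function `y ↦ ‖iteratedFDeriv ℝ 2 a_R y‖` (continuous, compact support)
  have hc : Continuous fun y => ‖iteratedFDeriv ℝ 2 (bumpSq η R) y‖ :=
    (hcd.continuous_iteratedFDeriv (le_refl _)).norm
  have hs : HasCompactSupport fun y => ‖iteratedFDeriv ℝ 2 (bumpSq η R) y‖ := (hcs.iteratedFDeriv 2).norm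
  obtain ⟨A, hA⟩ := hc.bounded_above_of_compact_support hs
  have hA' : ∀ y, ‖fderiv ℝ (fderiv ℝ (bumpSq η R)) y‖ ≤ A := fun y => by
    rw [← norm_iteratedFDeriv_one (𝕜 := ℝ) (fderiv ℝ (bumpSq η R)), norm_iteratedFDeriv_fderiv]
    exact (le_abs_self _).trans ((Real.norm_eq_abs _).symm.le.trans (hA y))
  refine ⟨2 * A, fun x z => ?_⟩
  have h := norm_secondDiff_le (F := ℝ) hcd hA' x z
  rw [smul_eq_mul, Real.norm_eq_abs] at h
  exact h

/-- Uniform bound and far-field decay of `Λ a₁` (`a₁ = bumpSq η 1`, supported in `B₂(0)`):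
`|Λ a₁ (y)| ≤ B` everywhere and `|Λ a₁ (y)| ≤ 16 ‖a₁‖_{L¹} lamK y` for `‖y‖ ≥ 4`. -/
theorem exists_bounds_fracLapHalfS_bumpSq_one (hη : IsAdmissibleBump η) :
    ∃ B : ℝ, 0 ≤ B ∧ (∀ y, |fracLapHalfS (bumpSq η 1) y| ≤ B) ∧
      ∀ y : EuclideanSpace ℝ (Fin 3), 4 ≤ ‖y‖ →
        |fracLapHalfS (bumpSq η 1) y| ≤ 16 * (∫ w, |bumpSq η 1 w|) * lamK y := by
  obtain ⟨A₂, hA₂⟩ := exists_secondDiff_bound_bumpSq hη one_pos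
  have ha0 : ∀ x, |bumpSq η 1 x| ≤ 1 := fun x => by
    rw [abs_of_nonneg (bumpSq_nonneg η 1 x)]; exact bumpSq_le_one hη 1 x
  obtain ⟨g, hgi, hgnn, hg⟩ := exists_majorant_secondDiff_real ha0 hA₂
  have hai : Integrable (bumpSq η 1) := (continuous_bumpSq hη 1).integrable_of_hasCompactSupport
    (hasCompactSupport_bumpSq hη one_pos)
  have hsupp : ∀ x : EuclideanSpace ℝ (Fin 3), 2 ≤ ‖x‖ → bumpSq η 1 x = 0 := fun x hx =>
    bumpSq_eq_zero hη one_pos (by linarith)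
  refine ⟨(1 / 2 : ℝ) * ∫ z, g z, mul_nonneg (by norm_num) (integral_nonneg hgnn), fun y => ?_, fun y hy => ?_⟩
  · unfold fracLapHalfS
    rw [abs_mul, abs_of_pos (by norm_num : (0 : ℝ) < 1 / 2)]
    refine mul_le_mul_of_nonneg_left ?_ (by norm_num)
    have h := abs_secondDiffOp_real_le hgi hg 0 y
    rwa [lamKTrunc_zero] at h
  · unfold fracLapHalfS
    rw [abs_mul, abs_of_pos (by norm_num : (0 : ℝ) < 1 / 2)]
    have h := abs_secondDiffOp_real_le_far hai (by norm_num : (0 : ℝ) < 2) hsupp 0 (x := y) (by linarith)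
    rw [lamKTrunc_zero] at h
    linarith

/-- **`c₁(η) < ∞`**: `y ↦ ‖y‖⁻² |Λ a₁ (y)|` is integrable on `ℝ³` (`‖y‖⁻²` against the uniform bound on `B₄(0)`,
`‖y‖⁻² · lamK y ≤ lamK y / 16` beyond). -/
theorem integrable_rpow_mul_abs_fracLapHalfS_bumpSq_one (hη : IsAdmissibleBump η) :
    Integrable (fun y : EuclideanSpace ℝ (Fin 3) => ‖y‖ ^ (-(2 : ℝ)) * |fracLapHalfS (bumpSq η 1) y|) := by
  obtain ⟨B, hB0, hB, hfar⟩ := exists_bounds_fracLapHalfS_bumpSq_one hη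
  set L1 : ℝ := ∫ w, |bumpSq η 1 w| with hL1
  have hL1nn : 0 ≤ L1 := integral_nonneg fun w => abs_nonneg _
  -- measurability: `Λ a₁` is continuous
  obtain ⟨A₂, hA₂⟩ := exists_secondDiff_bound_bumpSq hη one_pos
  have ha0 : ∀ x, |bumpSq η 1 x| ≤ 1 := fun x => by
    rw [abs_of_nonneg (bumpSq_nonneg η 1 x)]; exact bumpSq_le_one hη 1 x
  have hΛc : Continuous (fracLapHalfS (bumpSq η 1)) := by
    have h := continuous_secondDiffOp_real (continuous_bumpSq hη 1) ha0 hA₂ 0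
    rw [lamKTrunc_zero] at h
    exact continuous_const.mul h
  have hmeas : AEStronglyMeasurable
      (fun y : EuclideanSpace ℝ (Fin 3) => ‖y‖ ^ (-(2 : ℝ)) * |fracLapHalfS (bumpSq η 1) y|) volume :=
    ((continuous_norm.measurable.pow_const _).mul hΛc.measurable.abs).aestronglyMeasurable
  -- dominating function
  have hdom : Integrable (fun y : EuclideanSpace ℝ (Fin 3) =>
      (ball (0 : EuclideanSpace ℝ (Fin 3)) 4).indicator (fun y => B * ‖y‖ ^ (-(2 : ℝ))) y + L1 * lamKTrunc 2 y) := by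
    refine Integrable.add ?_ ((integrable_lamKTrunc (by norm_num : (0 : ℝ) < 2)).const_mul _)
    refine IntegrableOn.integrable_indicator ?_ measurableSet_ball
    have hm : Measurable fun y : EuclideanSpace ℝ (Fin 3) => B * ‖y‖ ^ (-(2 : ℝ)) :=
      Measurable.const_mul (continuous_norm.measurable.pow_const _) _
    exact integrableOn_ball_of_norm_le_rpow (E := EuclideanSpace ℝ (Fin 3)) (F := ℝ) (μ := volume)
      (f := fun y => B * ‖y‖ ^ (-(2 : ℝ)))
      (by rw [finrank_euclideanSpace_fin]; norm_num) (C := B) (α := 2) (r := 4)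
      (by rw [finrank_euclideanSpace_fin]; norm_num)
      (ae_of_all _ fun y => by rw [Real.norm_eq_abs, abs_of_nonneg (by positivity)])
      hm.aestronglyMeasurable
  refine hdom.mono' hmeas (ae_of_all _ fun y => ?_)
  rw [Real.norm_eq_abs, abs_of_nonneg (by positivity)]
  by_cases hy : y ∈ ball (0 : EuclideanSpace ℝ (Fin 3)) 4
  · rw [indicator_of_mem hy]
    have h1 : ‖y‖ ^ (-(2 : ℝ)) * |fracLapHalfS (bumpSq η 1) y| ≤ B * ‖y‖ ^ (-(2 : ℝ)) := by
      rw [mul_comm B]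
      exact mul_le_mul_of_nonneg_left (hB y) (Real.rpow_nonneg (norm_nonneg _) _)
    have h2 : 0 ≤ L1 * lamKTrunc 2 y := mul_nonneg hL1nn (lamKTrunc_nonneg 2 y)
    linarith
  · rw [indicator_of_notMem hy, zero_add]
    have hy4 : 4 ≤ ‖y‖ := by simpa [mem_ball, dist_zero_right] using hy
    have hypos : 0 < ‖y‖ := by linarith
    have hK : lamKTrunc 2 y = lamK y := lamKTrunc_of_lt (by linarith)
    have hr : ‖y‖ ^ (-(2 : ℝ)) ≤ 1 / 16 := by
      rw [Real.rpow_neg hypos.le, show (2 : ℝ) = ((2 : ℕ) : ℝ) by norm_num, Real.rpow_natCast]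
      rw [show (1 : ℝ) / 16 = (4 ^ 2)⁻¹ by norm_num]
      exact inv_anti₀ (by positivity) (pow_le_pow_left₀ (by norm_num) hy4 2)
    calc ‖y‖ ^ (-(2 : ℝ)) * |fracLapHalfS (bumpSq η 1) y| ≤ (1 / 16) * (16 * L1 * lamK y) :=
          mul_le_mul hr (hfar y hy4) (abs_nonneg _) (by norm_num)
      _ = L1 * lamKTrunc 2 y := by rw [hK]; ring

/-- **The decay bookkeeping, uniform in `R`**: if `‖f x‖ ≤ D/‖x‖` off the origin then for every `R > 0`
`∫ ‖f x‖² |Λ a_R (x)| dx ≤ D² · c₁(η)` with `c₁(η) = ∫ ‖y‖⁻² |Λ a₁ (y)| dy` (scaling + `x = R y`). -/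
theorem integral_normSq_mul_abs_fracLapHalfS_le (hη : IsAdmissibleBump η)
    {f : EuclideanSpace ℝ (Fin 3) → EuclideanSpace ℝ (Fin 3)} {D : ℝ}
    (hf : ∀ x : EuclideanSpace ℝ (Fin 3), x ≠ 0 → ‖f x‖ ≤ D / ‖x‖) {R : ℝ} (hR : 0 < R) :
    ∫ x, ‖f x‖ ^ 2 * |fracLapHalfS (bumpSq η R) x| ≤
      D ^ 2 * ∫ y : EuclideanSpace ℝ (Fin 3), ‖y‖ ^ (-(2 : ℝ)) * |fracLapHalfS (bumpSq η 1) y| := by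
  set m : EuclideanSpace ℝ (Fin 3) → ℝ := fun y => ‖y‖ ^ (-(2 : ℝ)) * |fracLapHalfS (bumpSq η 1) y| with hm
  have hmi : Integrable m := integrable_rpow_mul_abs_fracLapHalfS_bumpSq_one hη
  have hRi : 0 < R⁻¹ := inv_pos.2 hR
  -- the rescaled majorant `x ↦ D² R⁻³ m (R⁻¹ x)` and its integral
  have hmsi : Integrable (fun x : EuclideanSpace ℝ (Fin 3) => m (R⁻¹ • x)) := hmi.comp_smul hRi.ne'
  have hval : ∫ x : EuclideanSpace ℝ (Fin 3), m (R⁻¹ • x) = R ^ 3 * ∫ y, m y := by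
    rw [Measure.integral_comp_smul volume m R⁻¹, finrank_euclideanSpace_fin,
      abs_of_pos (by positivity : (0 : ℝ) < ((R⁻¹) ^ 3)⁻¹), smul_eq_mul, inv_pow, inv_inv]
  -- pointwise a.e.: `‖f x‖² |Λ a_R x| ≤ D² R⁻³ m (R⁻¹ x)`
  have h0 : ∀ᵐ x ∂(volume : Measure (EuclideanSpace ℝ (Fin 3))), x ≠ 0 := by
    rw [ae_iff]; simp
  have hpt : ∀ᵐ x ∂(volume : Measure (EuclideanSpace ℝ (Fin 3))),
      ‖f x‖ ^ 2 * |fracLapHalfS (bumpSq η R) x| ≤ D ^ 2 * (R ^ 3)⁻¹ * m (R⁻¹ • x) := by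
    filter_upwards [h0] with x hx
    have hxpos : 0 < ‖x‖ := norm_pos_iff.2 hx
    have hfx : ‖f x‖ ^ 2 ≤ D ^ 2 * (‖x‖ ^ 2)⁻¹ := by
      calc ‖f x‖ ^ 2 ≤ (D / ‖x‖) ^ 2 := pow_le_pow_left₀ (norm_nonneg _) (hf x hx) 2
        _ = D ^ 2 * (‖x‖ ^ 2)⁻¹ := by rw [div_pow, div_eq_mul_inv]
    have hsc := fracLapHalfS_bumpSq_scale η hR x
    have hnorm : ‖R⁻¹ • x‖ ^ (-(2 : ℝ)) = R ^ 2 * (‖x‖ ^ 2)⁻¹ := by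
      rw [norm_smul, Real.norm_eq_abs, abs_of_pos hRi, Real.rpow_neg (by positivity),
        show (2 : ℝ) = ((2 : ℕ) : ℝ) by norm_num, Real.rpow_natCast, mul_pow, mul_inv, inv_pow, inv_inv]
    rw [hm]
    dsimp only
    rw [hnorm, hsc, abs_mul, abs_of_pos hRi]
    have hA : 0 ≤ |fracLapHalfS (bumpSq η 1) (R⁻¹ • x)| := abs_nonneg _
    calc ‖f x‖ ^ 2 * (R⁻¹ * |fracLapHalfS (bumpSq η 1) (R⁻¹ • x)|)
        ≤ D ^ 2 * (‖x‖ ^ 2)⁻¹ * (R⁻¹ * |fracLapHalfS (bumpSq η 1) (R⁻¹ • x)|) :=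
          mul_le_mul_of_nonneg_right hfx (by positivity)
      _ = D ^ 2 * (R ^ 3)⁻¹ * (R ^ 2 * (‖x‖ ^ 2)⁻¹ * |fracLapHalfS (bumpSq η 1) (R⁻¹ • x)|) := by
          field_simp
  calc ∫ x, ‖f x‖ ^ 2 * |fracLapHalfS (bumpSq η R) x|
      ≤ ∫ x, D ^ 2 * (R ^ 3)⁻¹ * m (R⁻¹ • x) :=
        integral_mono_of_nonneg (ae_of_all _ fun x => by positivity) (hmsi.const_mul _) hpt
    _ = D ^ 2 * (R ^ 3)⁻¹ * (R ^ 3 * ∫ y, m y) := by rw [integral_const_mul, hval]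
    _ = D ^ 2 * ∫ y, m y := by field_simp

/-! ### Door-class slices meet the hypotheses of the identity -/

/-- **Regularity of a door-class slice** (`t < 0`): `v t` is `C²` and continuous, bounded by `C/√(−t)`,
`K/(−t)`-Lipschitz, with second differences `≤ 2K(−t)^{−3/2}‖z‖²` (Type-I rate, slice analyticity, binder). -/
theorem slice_regularity {C K : ℝ} {v : ℝ → EuclideanSpace ℝ (Fin 3) → EuclideanSpace ℝ (Fin 3)}
    (hrate : HasTypeITimeDecay C v) (hder : HasTypeIDerivDecay K v)
    (hcont : ContinuousOn (Function.uncurry v) (Set.Iio (0 : ℝ) ×ˢ Set.univ))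
    (hmild : ∀ s t : ℝ, s < t → t < 0 → ∀ x,
      v t x = UnboundedOperators.heatExtension (v s) (t - s) x - oseenDuhamel 1 s v v t x)
    {t : ℝ} (ht : t < 0) :
    ContDiff ℝ 2 (v t) ∧ Continuous (v t) ∧ (∀ x, ‖v t x‖ ≤ C / Real.sqrt (-t)) ∧
      (∀ x y, ‖v t x - v t y‖ ≤ K / (-t) * ‖x - y‖) ∧
      ∀ x z, ‖(2 : ℝ) • v t x - v t (x + z) - v t (x - z)‖ ≤ 2 * (K / Real.sqrt (-t) ^ 3) * ‖z‖ ^ 2 := by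
  have hnt : 0 < -t := neg_pos.2 ht
  have hsq : 0 < Real.sqrt (-t) := Real.sqrt_pos.2 hnt
  have han : AnalyticOnNhd ℝ (v t) univ := analyticOnNhd_slice hcont (bdd_of_hasTypeITimeDecay hrate) hmild ht
  have hcd : ContDiff ℝ 2 (v t) := contDiff_iff_contDiffAt.2 fun x => (han x (mem_univ x)).contDiffAt
  have hdiff : Differentiable ℝ (v t) := hcd.differentiable (by norm_num)
  -- first derivative bound `‖∇v‖ ≤ K/(−t)`
  have hD1 : ∀ x, ‖fderiv ℝ (v t) x‖ ≤ K / (-t) := fun x => by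
    have h := (hder t ht x).1
    have hK : 0 ≤ K := hder.nonneg
    have hden : (-t) ≤ (‖x‖ + Real.sqrt (-t)) ^ 2 := by
      have : Real.sqrt (-t) ^ 2 = -t := Real.sq_sqrt hnt.le
      nlinarith [norm_nonneg x, hsq.le]
    rw [le_div_iff₀ hnt]
    calc ‖fderiv ℝ (v t) x‖ * -t ≤ ‖fderiv ℝ (v t) x‖ * (‖x‖ + Real.sqrt (-t)) ^ 2 :=
          mul_le_mul_of_nonneg_left hden (norm_nonneg _)
      _ ≤ K := by rw [mul_comm]; exact h
  -- second derivative bound `‖∇²v‖ ≤ K/√(−t)³`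
  have hD2 : ∀ x, ‖fderiv ℝ (fderiv ℝ (v t)) x‖ ≤ K / Real.sqrt (-t) ^ 3 := fun x => by
    have h := (hder t ht x).2.1
    have hden : Real.sqrt (-t) ^ 3 ≤ (‖x‖ + Real.sqrt (-t)) ^ 3 :=
      pow_le_pow_left₀ hsq.le (by linarith [norm_nonneg x]) 3
    rw [← norm_iteratedFDeriv_one (𝕜 := ℝ) (fderiv ℝ (v t)), norm_iteratedFDeriv_fderiv, le_div_iff₀ (by positivity)]
    calc ‖iteratedFDeriv ℝ 2 (v t) x‖ * Real.sqrt (-t) ^ 3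
        ≤ ‖iteratedFDeriv ℝ 2 (v t) x‖ * (‖x‖ + Real.sqrt (-t)) ^ 3 :=
          mul_le_mul_of_nonneg_left hden (norm_nonneg _)
      _ ≤ K := by rw [mul_comm]; exact h
  refine ⟨hcd, hcd.continuous, fun x => hrate t ht x, fun x y => ?_, fun x z => norm_secondDiff_le hcd hD2 x z⟩
  exact Convex.norm_image_sub_le_of_norm_fderiv_le (fun z _ => hdiff z) (fun z _ => hD1 z) convex_univ
    (mem_univ y) (mem_univ x)

/-! ### Stub B1′ -/

/-- **Stub B1′ `stub_localHelicityLower` of nsreg-p1 `r19/Sketch20v5.lean` (text verbatim over the tree substrate),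
PROVED — LOCALISED HELICITY IS ALMOST COERCIVE.**  For a chiral slice of a door-class profile
(`curl v(t) = Λ v(t)`), the weighted Gagliardo form of `v(t)` with weight `a_R = η(·/R)²` is bounded by the localised
helicity `∫ a_R ⟪v, curl v⟫` plus a constant `c = ½ D² c₁(η)` INDEPENDENT of `R > 0` and `t < 0`:
Gagliardo–`Λ` identity + chirality + the scale-invariant decay bookkeeping `½∫‖v‖²|Λ a_R| ≤ ½ D² ∫‖y‖⁻²|Λ a₁|`. -/
theorem localHelicityLower : ∀ (η : EuclideanSpace ℝ (Fin 3) → ℝ), IsAdmissibleBump η → ∀ (C D K : ℝ)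
    (v : ℝ → EuclideanSpace ℝ (Fin 3) → EuclideanSpace ℝ (Fin 3)),
    HasTypeITimeDecay C v → HasTypeIDecay D v → HasTypeIDerivDecay K v →
    ContinuousOn (Function.uncurry v) (Set.Iio (0 : ℝ) ×ˢ Set.univ) →
    (∀ s t : ℝ, s < t → t < 0 → ∀ x,
        v t x = UnboundedOperators.heatExtension (v s) (t - s) x - oseenDuhamel 1 s v v t x) →
    (∀ t < 0, VectorCalculus.IsDivFree (v t)) → (∀ t < 0, IsChiral (v t)) →
    ∃ c : ℝ, ∀ R > (0 : ℝ), ∀ t < (0 : ℝ),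
      gagliardo (bumpSq η R) (v t) ≤ locHelicity (bumpSq η R) (v t) + c := by
  intro η hη C D K v hrate hdecay hder hcont hmild _hdiv hchi
  -- `0 ≤ D` (evaluate the decay bound anywhere)
  have hD : 0 ≤ D := by
    have h := hdecay (-1) (by norm_num) 0
    have hpos : 0 < ‖(0 : EuclideanSpace ℝ (Fin 3))‖ + Real.sqrt (-(-1 : ℝ)) := by
      rw [norm_zero, zero_add]; exact Real.sqrt_pos.2 (by norm_num)
    by_contra hD
    push Not at hD
    have : D / (‖(0 : EuclideanSpace ℝ (Fin 3))‖ + Real.sqrt (-(-1 : ℝ))) < 0 := div_neg_of_neg_of_pos hD hpos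
    linarith [norm_nonneg (v (-1) 0)]
  set c₁ : ℝ := ∫ y : EuclideanSpace ℝ (Fin 3), ‖y‖ ^ (-(2 : ℝ)) * |fracLapHalfS (bumpSq η 1) y| with hc₁
  refine ⟨(1 / 2 : ℝ) * (D ^ 2 * c₁), fun R hR t ht => ?_⟩
  -- the weight
  have hac : Continuous (bumpSq η R) := continuous_bumpSq hη R
  have hann : ∀ x, 0 ≤ bumpSq η R x := bumpSq_nonneg η R
  have ha0 : ∀ x, |bumpSq η R x| ≤ 1 := fun x => by
    rw [abs_of_nonneg (hann x)]; exact bumpSq_le_one hη R x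
  obtain ⟨A₂, hA₂⟩ := exists_secondDiff_bound_bumpSq hη hR
  have hρ : 0 < 2 * R := by positivity
  have hsupp : ∀ x : EuclideanSpace ℝ (Fin 3), 2 * R ≤ ‖x‖ → bumpSq η R x = 0 := fun x hx => bumpSq_eq_zero hη hR hx
  -- the slice
  obtain ⟨_, hfc, hf0, hf1, hf2⟩ := slice_regularity hrate hder hcont hmild ht
  -- the identity in inequality form
  have hG := gagliardo_le_integral_add hac hann ha0 hA₂ hρ hsupp hfc hf0 hf1 hf2
  -- chirality: `Λ v(t) = curl v(t)` turns the first term into the localised helicity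
  have hhel : (∫ x, bumpSq η R x * ⟪v t x, fracLapHalf (v t) x⟫) = locHelicity (bumpSq η R) (v t) := by
    unfold locHelicity
    refine integral_congr_ae (Eventually.of_forall fun x => ?_)
    show bumpSq η R x * ⟪v t x, fracLapHalf (v t) x⟫ = bumpSq η R x * ⟪v t x, curl (v t) x⟫
    rw [← hchi t ht x]
  -- decay bookkeeping
  have hdec' : ∀ x : EuclideanSpace ℝ (Fin 3), x ≠ 0 → ‖v t x‖ ≤ D / ‖x‖ := fun x hx => by
    have hxpos : 0 < ‖x‖ := norm_pos_iff.2 hx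
    refine (hdecay t ht x).trans (div_le_div_of_nonneg_left hD hxpos ?_)
    linarith [Real.sqrt_nonneg (-t)]
  have hbook := integral_normSq_mul_abs_fracLapHalfS_le hη hdec' hR (f := v t)
  rw [hhel] at hG
  calc gagliardo (bumpSq η R) (v t)
      ≤ locHelicity (bumpSq η R) (v t) + (1 / 2 : ℝ) * ∫ x, ‖v t x‖ ^ 2 * |fracLapHalfS (bumpSq η R) x| := hG
    _ ≤ locHelicity (bumpSq η R) (v t) + (1 / 2 : ℝ) * (D ^ 2 * c₁) := by
        gcongr

/-- **Corollary: the localised helicity of a chiral door-class profile is almost non-negative**,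
`locHelicity a_R (v t) ≥ −c` uniformly in `R > 0`, `t < 0` (B1′ and `gagliardo ≥ 0`). -/
theorem locHelicity_ge_neg_const : ∀ (η : EuclideanSpace ℝ (Fin 3) → ℝ), IsAdmissibleBump η → ∀ (C D K : ℝ)
    (v : ℝ → EuclideanSpace ℝ (Fin 3) → EuclideanSpace ℝ (Fin 3)),
    HasTypeITimeDecay C v → HasTypeIDecay D v → HasTypeIDerivDecay K v →
    ContinuousOn (Function.uncurry v) (Set.Iio (0 : ℝ) ×ˢ Set.univ) →
    (∀ s t : ℝ, s < t → t < 0 → ∀ x,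
        v t x = UnboundedOperators.heatExtension (v s) (t - s) x - oseenDuhamel 1 s v v t x) →
    (∀ t < 0, VectorCalculus.IsDivFree (v t)) → (∀ t < 0, IsChiral (v t)) →
    ∃ c : ℝ, ∀ R > (0 : ℝ), ∀ t < (0 : ℝ), -c ≤ locHelicity (bumpSq η R) (v t) := by
  intro η hη C D K v hrate hdecay hder hcont hmild hdiv hchi
  obtain ⟨c, hc⟩ := localHelicityLower η hη C D K v hrate hdecay hder hcont hmild hdiv hchi
  refine ⟨c, fun R hR t ht => ?_⟩
  have h := hc R hR t ht
  have hG : 0 ≤ gagliardo (bumpSq η R) (v t) := gagliardo_nonneg (bumpSq_nonneg η R) _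
  linarith

end Summit.NavierStokesRegularity.NavierStokesRegularity.Theorems.ChiralWindowDoorLocalHelicityLower
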